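import Literature.Probability.RandomPlanarGeometry.PolylineUniform
import Summits.CriticalPhenomena.SAWScalingLimit.Theorems.ObservableToSLE.Negative.CompactContainer
import HarnessLib

/-!
# `ModulusUniversality`, line `birth`: the concatenation lemma in curve space (stub L, layer 3)

Helper file (`--supports stmt-CriticalPhenomena-5790`) of the line `birth` / `registered` for the
crux `SAWBrickWallHomotopy.ModulusUniversality` (skeleton
`Summits/CriticalPhenomena/SAWScalingLimit/Cruxes/ModulusUniversality/Lines/birth.lean`): the
registered helper sub-goal `dist_mk_polyline_commonMiddle_le` of the open stub L
(`stub_jitteredLipMerging`, bounded-Lipschitz merging of the straight and the jittered brick-wall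
laws), proved — the purely geometric CONCATENATION LEMMA in `CurveClass` (curves modulo
increasing reparametrisation) used by the reduction of stub L to the lattice statement
`MiddleCoupling` (file `…LipOfMiddleCoupling.lean`).

**Statement.** Two polylines whose vertex lists `α₁ ++ m ++ β₁`, `α₂ ++ m ++ β₂` share a COMMON
middle block `m`, with all prefix vertices (`α₁`, `α₂`) and both first vertices in the closed
`ρ`-ball at `p`, and all suffix vertices (`β₁`, `β₂`) and both last vertices in the closed
`ρ`-ball at `q`, are at `CurveClass` distance `≤ 2ρ`.  The first/last-vertex hypotheses are what
makes the degenerate cases (empty prefix, suffix or middle block) true.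

**Proof (padding).** Duplicating the head of a vertex list does not change the polyline class:
the polyline of `x :: x :: l` rests at `x` during `[0, 1/2]` and then runs the polyline of
`x :: l` at double speed, i.e. it is the precomposition of the latter with the continuous monotone
onto map `t ↦ max (0, 2t - 1)`, at reparametrisation distance `0` (the tree's
`Curve.dist_precomp_eq_zero`); hence front padding by copies of the head
(`mk_polyline_replicate_append_cons`) and, through time reversal
(`Polyline.reverse_mk_polyline`, `CurveClass.reverse_reverse`), back padding by copies of the
last vertex (`mk_polyline_pad`) preserve the class.  Padding the first list by `|α₂|` copies of
its head and `|β₂|` copies of its last vertex, and the second symmetrically, puts the common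
blocks at the same positions in two lists of equal length whose corresponding vertices are
`2ρ`-close (prefix positions: both in the `ρ`-ball at `p`; middle: equal; suffix: both in the
`ρ`-ball at `q`), and `polyline` parametrises by list position only
(`ObservableToSLE.Negative.dist_polyline_map_le`, through the list of vertex pairs,
`dist_mk_polyline_fst_snd_le`).  Elementary; all bookkeeping tagged [folklore].
-/

noncomputable section

open MeasureTheory Filter Topology
open scoped NNReal ENNReal unitInterval
open Literature.Probability.LatticeModels
open Literature.Probability.RandomPlanarGeometry

namespace Summit.CriticalPhenomena.SAWScalingLimit.Cruxes.ModulusUniversality.Birth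

namespace Concatenation

variable {F : Type*} [NormedAddCommGroup F] [NormedSpace ℝ F]

/-! ### Padding a vertex list does not change the polyline class -/

/-- **Duplicating the head of a vertex list does not change the polyline class**: the polyline
of `x :: x :: l` rests at `x` during `[0, 1/2]` and then runs the polyline of `x :: l` at double
speed — the precomposition with the monotone onto map `t ↦ max (0, 2t - 1)`, at
reparametrisation distance `0` (`Curve.dist_precomp_eq_zero`). [folklore] -/
theorem mk_polyline_cons_cons_self (x : F) (l : List F) :
    CurveClass.mk ⟨polyline (x :: x :: l)⟩ = CurveClass.mk ⟨polyline (x :: l)⟩ := by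
  have hmem : ∀ t : I, max 0 (2 * (t : ℝ) - 1) ∈ I := fun t =>
    ⟨le_max_left _ _, max_le zero_le_one (by linarith [t.2.2])⟩
  let φ : C(I, I) := ⟨fun t => ⟨max 0 (2 * (t : ℝ) - 1), hmem t⟩, by fun_prop⟩
  have hφ : ∀ t : I, (φ t : ℝ) = max 0 (2 * (t : ℝ) - 1) := fun t => rfl
  have hφ_mono : Monotone φ := fun s t hst => by
    show max 0 (2 * (s : ℝ) - 1) ≤ max 0 (2 * (t : ℝ) - 1)
    have : (s : ℝ) ≤ t := hst
    exact max_le_max le_rfl (by linarith)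
  have hφ0 : φ 0 = 0 := Subtype.ext (by rw [hφ]; norm_num)
  have hφ1 : φ 1 = 1 := Subtype.ext (by rw [hφ]; norm_num)
  have heq : (⟨polyline (x :: l)⟩ : Curve F).precomp φ = ⟨polyline (x :: x :: l)⟩ := by
    ext t
    show (polylineFrom x l).2 (φ t) = ((Path.segment x x).trans (polylineFrom x l).2) t
    rw [Polyline.path_trans_apply_ite]
    by_cases h : (t : ℝ) ≤ 1 / 2
    · rw [if_pos h, Path.segment_same, Path.refl_extend, ContinuousMap.const_apply]
      have hφt : φ t = 0 := Subtype.ext (by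
        rw [hφ]
        exact max_eq_left (by linarith))
      rw [hφt]
      exact (polylineFrom x l).2.source
    · rw [if_neg h, Path.extend_apply _ ⟨by linarith, by linarith [t.2.2]⟩]
      congr 1
      exact Subtype.ext (by rw [hφ]; exact max_eq_right (by linarith))
  have h := Curve.dist_precomp_eq_zero ⟨polyline (x :: l)⟩ φ hφ_mono hφ0 hφ1
  rw [heq] at h
  exact CurveClass.mk_eq_mk_iff_dist_eq_zero.2 h

/-- **Front padding** by copies of the head does not change the polyline class. [folklore] -/
theorem mk_polyline_replicate_append_cons (j : ℕ) (x : F) (l : List F) :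
    CurveClass.mk ⟨polyline (List.replicate j x ++ x :: l)⟩ = CurveClass.mk ⟨polyline (x :: l)⟩ := by
  induction j with
  | zero => rw [List.replicate_zero, List.nil_append]
  | succ j ih =>
    rw [List.replicate_succ, List.cons_append]
    cases j with
    | zero => rw [List.replicate_zero, List.nil_append, mk_polyline_cons_cons_self]
    | succ j =>
      rw [List.replicate_succ, List.cons_append] at ih ⊢
      rw [mk_polyline_cons_cons_self, ih]

/-- **Two-sided padding** of a nonempty vertex list by copies of its head in front and copies of
its last vertex at the back does not change the polyline class (back padding = front padding of
the reversed list: `Polyline.reverse_mk_polyline`, `CurveClass.reverse_reverse`). [folklore] -/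
theorem mk_polyline_pad (L : List F) {x y : F} (hx : L.head? = some x) (hy : L.getLast? = some y)
    (j k : ℕ) :
    CurveClass.mk ⟨polyline (List.replicate j x ++ L ++ List.replicate k y)⟩ =
      CurveClass.mk ⟨polyline L⟩ := by
  obtain ⟨tl, htl⟩ := List.head?_eq_some_iff.1 hx
  obtain ⟨L', rfl⟩ := List.getLast?_eq_some_iff.1 hy
  -- front padding
  have h1 : CurveClass.mk ⟨polyline (List.replicate j x ++ (L' ++ [y]) ++ List.replicate k y)⟩ =
      CurveClass.mk ⟨polyline ((L' ++ [y]) ++ List.replicate k y)⟩ := by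
    rw [List.append_assoc (List.replicate j x), htl, List.cons_append,
      mk_polyline_replicate_append_cons]
  -- back padding, through time reversal
  have h2 : (CurveClass.mk ⟨polyline ((L' ++ [y]) ++ List.replicate k y)⟩).reverse =
      (CurveClass.mk ⟨polyline (L' ++ [y])⟩).reverse := by
    rw [Polyline.reverse_mk_polyline, Polyline.reverse_mk_polyline, List.reverse_append,
      List.reverse_replicate, List.reverse_append, List.reverse_singleton, List.singleton_append,
      mk_polyline_replicate_append_cons]
  rw [h1, ← CurveClass.reverse_reverse (CurveClass.mk _), h2, CurveClass.reverse_reverse]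

/-! ### Positionwise comparison of two vertex lists of equal length -/

open Summit.CriticalPhenomena.SAWScalingLimit.Theorems.ObservableToSLE.Negative
  (dist_polyline_map_le) in
/-- Polylines through two vertex lists of equal length whose corresponding vertices are `ε`-close
(given as ONE list of vertex pairs) are `ε`-close as curve classes: `polyline` parametrises by
list position only (`dist_polyline_map_le` with the two projections). [folklore] -/
theorem dist_mk_polyline_fst_snd_le (l : List (F × F)) {ε : ℝ} (hε : 0 ≤ ε)
    (h : ∀ v ∈ l, dist v.1 v.2 ≤ ε) :
    dist (CurveClass.mk ⟨polyline (l.map Prod.fst)⟩) (CurveClass.mk ⟨polyline (l.map Prod.snd)⟩)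
      ≤ ε := by
  rw [CurveClass.dist_mk_mk]
  exact (Curve.dist_le_dist_toContinuousMap _ _).trans (dist_polyline_map_le _ _ hε l h)

omit [NormedSpace ℝ F] in
/-- Corresponding entries of the zip of two lists lying in one closed `ρ`-ball are `2ρ`-close.
[folklore] -/
theorem dist_le_of_mem_zip {l₁ l₂ : List F} {c : F} {ρ : ℝ} (h₁ : ∀ z ∈ l₁, dist z c ≤ ρ)
    (h₂ : ∀ z ∈ l₂, dist z c ≤ ρ) {v : F × F} (hv : v ∈ l₁.zip l₂) : dist v.1 v.2 ≤ 2 * ρ := by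
  obtain ⟨a, b⟩ := v
  obtain ⟨ha, hb⟩ := List.of_mem_zip hv
  calc dist a b ≤ dist a c + dist b c := dist_triangle_right _ _ _
    _ ≤ ρ + ρ := add_le_add (h₁ a ha) (h₂ b hb)
    _ = 2 * ρ := by ring

/-! ### The concatenation lemma -/

/-- **Concatenation lemma** (any real normed space). Two polylines whose vertex lists share a
common middle block `m`, with the two prefixes and both first vertices in the closed `ρ`-ball
at `p` and the two suffixes and both last vertices in the closed `ρ`-ball at `q`, are at
`CurveClass` distance `≤ 2ρ`: pad each list by copies of its first vertex in front and of its
last vertex at the back (classes unchanged, `mk_polyline_pad`) so that the common blocks occupy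
the same positions in two lists of equal length, and compare positionwise
(`dist_mk_polyline_fst_snd_le`; prefix positions are `2ρ`-close through `p`, suffix positions
through `q`, middle positions coincide).  The first/last-vertex hypotheses make the degenerate
cases of empty prefixes, suffixes or middle block true. [folklore] -/
theorem dist_mk_polyline_commonMiddle_le' (p q : F) {ρ : ℝ} (hρ : 0 ≤ ρ)
    (α₁ β₁ α₂ β₂ m : List F) {x₁ y₁ x₂ y₂ : F} (hx₁ : (α₁ ++ m ++ β₁).head? = some x₁)
    (hy₁ : (α₁ ++ m ++ β₁).getLast? = some y₁) (hx₂ : (α₂ ++ m ++ β₂).head? = some x₂)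
    (hy₂ : (α₂ ++ m ++ β₂).getLast? = some y₂) (hpx₁ : dist x₁ p ≤ ρ) (hqy₁ : dist y₁ q ≤ ρ)
    (hpx₂ : dist x₂ p ≤ ρ) (hqy₂ : dist y₂ q ≤ ρ) (hα : ∀ z ∈ α₁ ++ α₂, dist z p ≤ ρ)
    (hβ : ∀ z ∈ β₁ ++ β₂, dist z q ≤ ρ) :
    dist (CurveClass.mk ⟨polyline (α₁ ++ m ++ β₁)⟩) (CurveClass.mk ⟨polyline (α₂ ++ m ++ β₂)⟩)
      ≤ 2 * ρ := by
  -- the padded prefixes and suffixes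
  set P₁ : List F := List.replicate α₂.length x₁ ++ α₁ with hP₁
  set P₂ : List F := List.replicate α₁.length x₂ ++ α₂ with hP₂
  set S₁ : List F := β₁ ++ List.replicate β₂.length y₁ with hS₁
  set S₂ : List F := β₂ ++ List.replicate β₁.length y₂ with hS₂
  have hP : P₁.length = P₂.length := by
    simp only [hP₁, hP₂, List.length_append, List.length_replicate]; omega
  have hS : S₁.length = S₂.length := by
    simp only [hS₁, hS₂, List.length_append, List.length_replicate]; omega
  -- the list of vertex pairs and its two projections (the padded lists)
  set l : List (F × F) := P₁.zip P₂ ++ m.map (fun z => (z, z)) ++ S₁.zip S₂ with hl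
  have hm₁ : (m.map fun z : F => (z, z)).map Prod.fst = m := by simp [Function.comp_def]
  have hm₂ : (m.map fun z : F => (z, z)).map Prod.snd = m := by simp [Function.comp_def]
  have hl₁ : l.map Prod.fst = List.replicate α₂.length x₁ ++ (α₁ ++ m ++ β₁) ++
      List.replicate β₂.length y₁ := by
    rw [hl, List.map_append, List.map_append, List.map_fst_zip hP.le, List.map_fst_zip hS.le, hm₁,
      hP₁, hS₁]
    simp only [List.append_assoc]
  have hl₂ : l.map Prod.snd = List.replicate α₁.length x₂ ++ (α₂ ++ m ++ β₂) ++
      List.replicate β₁.length y₂ := by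
    rw [hl, List.map_append, List.map_append, List.map_snd_zip hP.ge, List.map_snd_zip hS.ge, hm₂,
      hP₂, hS₂]
    simp only [List.append_assoc]
  -- positionwise closeness
  have hP₁c : ∀ z ∈ P₁, dist z p ≤ ρ := fun z hz => by
    rcases List.mem_append.1 hz with h | h
    · rw [List.eq_of_mem_replicate h]; exact hpx₁
    · exact hα z (List.mem_append_left _ h)
  have hP₂c : ∀ z ∈ P₂, dist z p ≤ ρ := fun z hz => by
    rcases List.mem_append.1 hz with h | h
    · rw [List.eq_of_mem_replicate h]; exact hpx₂
    · exact hα z (List.mem_append_right _ h)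
  have hS₁c : ∀ z ∈ S₁, dist z q ≤ ρ := fun z hz => by
    rcases List.mem_append.1 hz with h | h
    · exact hβ z (List.mem_append_left _ h)
    · rw [List.eq_of_mem_replicate h]; exact hqy₁
  have hS₂c : ∀ z ∈ S₂, dist z q ≤ ρ := fun z hz => by
    rcases List.mem_append.1 hz with h | h
    · exact hβ z (List.mem_append_right _ h)
    · rw [List.eq_of_mem_replicate h]; exact hqy₂
  have hclose : ∀ v ∈ l, dist v.1 v.2 ≤ 2 * ρ := fun v hv => by
    rcases List.mem_append.1 hv with hv | hv
    · rcases List.mem_append.1 hv with hv | hv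
      · exact dist_le_of_mem_zip hP₁c hP₂c hv
      · obtain ⟨z, -, rfl⟩ := List.mem_map.1 hv
        rw [dist_self]; positivity
    · exact dist_le_of_mem_zip hS₁c hS₂c hv
  rw [← mk_polyline_pad (α₁ ++ m ++ β₁) hx₁ hy₁ α₂.length β₂.length,
    ← mk_polyline_pad (α₂ ++ m ++ β₂) hx₂ hy₂ α₁.length β₁.length, ← hl₁, ← hl₂]
  exact dist_mk_polyline_fst_snd_le l (by positivity) hclose

end Concatenation

/-! ### The registered helper sub-goal -/

/-- **Concatenation lemma in `CurveClass ℂ` (registered helper sub-goal of stub L, literal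
signature).** Two planar polylines whose vertex lists `α₁ ++ m ++ β₁`, `α₂ ++ m ++ β₂` share a
COMMON middle block `m`, with all prefix vertices and both first vertices in the closed `ρ`-ball
at `p` and all suffix vertices and both last vertices in the closed `ρ`-ball at `q`, are at
`CurveClass` distance `≤ 2ρ` (`Concatenation.dist_mk_polyline_commonMiddle_le'`: padding +
positionwise comparison).  Used with `p = E.pt 0`, `q = E.pt 1` for the straight drawings of two
coupled brick-wall walks agreeing off the `ρ`-balls at the marked points. [folklore] -/
theorem dist_mk_polyline_commonMiddle_le : ∀ (p q : ℂ) (ρ : ℝ), 0 ≤ ρ → ∀ (α₁ β₁ α₂ β₂ m : List ℂ) (x₁ y₁ x₂ y₂ : ℂ), (α₁ ++ m ++ β₁).head? = some x₁ → (α₁ ++ m ++ β₁).getLast? = some y₁ → (α₂ ++ m ++ β₂).head? = some x₂ → (α₂ ++ m ++ β₂).getLast? = some y₂ → dist x₁ p ≤ ρ → dist y₁ q ≤ ρ → dist x₂ p ≤ ρ → dist y₂ q ≤ ρ → (∀ z ∈ α₁ ++ α₂, dist z p ≤ ρ) → (∀ z ∈ β₁ ++ β₂, dist z q ≤ ρ)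 → dist (CurveClass.mk ⟨polyline (α₁ ++ m ++ β₁)⟩) (CurveClass.mk ⟨polyline (α₂ ++ m ++ β₂)⟩) ≤ 2 * ρ :=
  fun p q _ hρ α₁ β₁ α₂ β₂ m _ _ _ _ =>
    Concatenation.dist_mk_polyline_commonMiddle_le' p q hρ α₁ β₁ α₂ β₂ m

end Summit.CriticalPhenomena.SAWScalingLimit.Cruxes.ModulusUniversality.Birth

end
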